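import Summits.BirchSwinnertonDyer.BirchSwinnertonDyer.Theorems.GoldfeldAllTwistsTwoConverseSplitGlueTwin
import HarnessLib

/-! # Candidate skeleton «cells-v2» — crux `BSDTwoCMSplitRankOne` (formula twin) of route `GoldfeldAllTwistsTwoConverse`
(item stmt-BirchSwinnertonDyer-19350; leafhand `leafhand-bsd-goldfeldalltwistst-1` g0, 2026-08-30; NOT registered by this seat —
offered to the route owner / ladder director as the replacement of the birth skeleton `Lines/birth.lean` sha16 d825bf121a73b7e3)

WHY: of the two birth stubs, `stub_bsdTwo_cmSplit_good` is Li–Tian–Yan–Zhu 2025 Thm. 1.1 (ii) at `p = 2` (a PRINT, never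
closable by name as registered: conditional closer `GoldfeldGoodTwists.bsdTwo_cmSplit_goodCell_of_thm11`, no `_holds` of
`LiTianYanZhu2025.thm11_bsdp_of_cm_rank_one`), and `stub_bsdTwo_cmSplit_additive` is VERBATIM the child crux twin″ (item 19140).
The item is already SPLIT on the ledger (gen 1: 19140 + 19141 + glue 19142, glue PROVED). This skeleton states the same split with
TWO stubs that are declarations of the tree BY NAME — the route's printed support item `LTYZThm11CMRankOnePPart` (item 19141,
:= the Literature fact) and the child crux — and the composition is the landed glue `GoldfeldGoodTwists.bsdTwoCMSplitRankOne_of_cells`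
(file `…SplitGlueTwin`; exactness `ltyzPotentiallyGoodOrdinaryAtTwo_iff_additiveCell`). Sorries ONLY in `stub_*`.
HONEST FRAMING: bookkeeping; nothing here proves the twin, twin″, LTYZ Thm. 1.1 or BSD. -/

set_option linter.dupNamespace false
set_option autoImplicit false

namespace Summit.BirchSwinnertonDyer.BirchSwinnertonDyer.Cruxes.BSDTwoCMSplitRankOne.CellsV2

open Summit.BirchSwinnertonDyer.BirchSwinnertonDyer.Theses.GoldfeldAllTwistsTwoConverse

/-- STUB (PRINT, by name): Li–Tian–Yan–Zhu 2025 Thm. 1.1 — the route's support item `LTYZThm11CMRankOnePPart` (item 19141) :=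
Literature fact `LiTianYanZhu2025.thm11_bsdp_of_cm_rank_one` (refereed statement; literature-formalisation debt). -/
theorem stub_ltyzThm11 : LTYZThm11CMRankOnePPart := by
  sorry

/-- STUB (CHILD CRUX, by name): the additive cell twin″ = route decl `BSDTwoCMSevenAdditiveRankOne` (item 19140, registered
skeleton with stubs `stub_heegnerIndexUpperAtTwo` / `stub_heegnerIndexLowerAtTwo` / `stub_publishedFactsTwinAtTwo`). -/
theorem stub_additiveCell : BSDTwoCMSevenAdditiveRankOne := by
  sorry

/-- Composition (PROVED, no sorry of its own): the crux BY NAME from the two stubs, via the landed glue. -/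
theorem BSDTwoCMSplitRankOne_of : BSDTwoCMSplitRankOne :=
  Summit.BirchSwinnertonDyer.BirchSwinnertonDyer.Theorems.GoldfeldGoodTwists.bsdTwoCMSplitRankOne_of_cells
    stub_additiveCell stub_ltyzThm11

end Summit.BirchSwinnertonDyer.BirchSwinnertonDyer.Cruxes.BSDTwoCMSplitRankOne.CellsV2
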